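import Mathlib
import Summits.AtomisticToContinuum.FouriersLaw.Theses.EmbeddedDrudeMourre
import Summits.AtomisticToContinuum.FouriersLaw.Theorems.EmbeddedDrudeMourreDrudeDissolutionStubExcursionSecondDifferenceGradientFloorFar
import Literature.NumberTheory.DiophantineApproximation.KroneckerTheorem
import HarnessLib

/-!
# Geometry of the free pair resonance for stub B1b″ of line `kinetic-polymer-gas-on-the-time-axis`:
# the volume of the tube around the diagonal of the cell
(crux `EmbeddedDrudeMourre.DrudeDissolution`, item stmt-AtomisticToContinuum-12593; `--supports` file, closes
nothing; lead c13, geometry input (G-T6a) of the B1b″ discard bound)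

WHAT. `cellMeasure_tube_diag_le` (G-T6a): on the cell `(−π,π]³` (product of restricted Lebesgue measures, read at
`p = (k₁,(k₃,k₂))`), the tube `{S₁² + S₂² < η²}` around the diagonal `k₁ ≡ k₂ ≡ k₃`, `S₁ = sin((k₃−k₁)/2)`,
`S₂ = sin((k₃−k₂)/2)`, has measure `≤ 32π³η²` for every `η > 0`. It is the codimension-2 part of the discard region of
the second-difference estimate B1b″ (the critical curves of `Ω` inside both exchange planes at once).

HOW. Jordan's inequality `(2/π)|t| ≤ |sin t|` on `|t| ≤ π/2` (reused from
`Literature.NumberTheory.DiophantineApproximation.Kronecker`) turns `|sin((x−y)/2)| < η` for `x, y` in the cell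
(`x − y ∈ (−2π, 2π)`) into `|x − y| < πη ∨ x > π − πη ∨ x < −π + πη` (`abs_sin_half_lt_windows`), whence the
one-dimensional bound `vol{x ∈ (−π,π] : |sin((x−y)/2)| < η} ≤ 4πη` (`volume_cell_abs_sin_half_lt_le`); two Tonelli
slices (`Measure.prod_apply`) then give `2π·(4πη)²`.
-/

noncomputable section

open Set Real Topology MeasureTheory
open scoped ENNReal
open Literature.MathematicalPhysics.KineticTheory
open Literature.MathematicalPhysics.KineticTheory.PhononBoltzmann

namespace Summit.AtomisticToContinuum.FouriersLaw.Theorems.DrudeDissolution.KineticPolymerGasOnTheTimeAxis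

/-! ### Jordan's inequality and the one-dimensional windows -/

/-- **Windows.** If `|u| < 2π` and `|sin(u/2)| < η`, then `|u| < πη`, or `u > 2π − πη`, or
`u < −2π + πη`. [folklore] -/
theorem abs_sin_half_lt_windows {u η : ℝ} (hu : |u| < 2 * Real.pi)
    (hs : |Real.sin (u / 2)| < η) :
    |u| < Real.pi * η ∨ 2 * Real.pi - Real.pi * η < u ∨ u < -(2 * Real.pi) + Real.pi * η := by
  have hπ := Real.pi_pos
  obtain ⟨hu1, hu2⟩ := abs_lt.1 hu
  by_cases hmid : |u / 2| ≤ Real.pi / 2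
  · left
    have hJ := Literature.NumberTheory.DiophantineApproximation.Kronecker.two_div_pi_mul_abs_le_abs_sin hmid
    have : 2 / Real.pi * |u / 2| = |u| / Real.pi := by
      rw [abs_div, abs_of_pos (by norm_num : (0 : ℝ) < 2)]
      field_simp
    rw [this] at hJ
    have h := lt_of_le_of_lt hJ hs
    rwa [div_lt_iff₀ hπ, mul_comm] at h
  · rw [not_le] at hmid
    rcases lt_or_gt_of_ne (show u / 2 ≠ 0 from fun h => by
        rw [h, abs_zero] at hmid; linarith) with hneg | hpos
    · -- `u/2 ∈ (−π, −π/2)`: use the angle `π + u/2 ∈ (0, π/2)`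
      right; right
      have hlt : u / 2 < -(Real.pi / 2) := by
        rw [abs_of_neg hneg] at hmid; linarith
      have h1 : 0 ≤ Real.pi + u / 2 := by linarith
      have h2 : Real.pi + u / 2 ≤ Real.pi / 2 := by linarith
      have hJ := Real.mul_le_sin h1 h2
      have hsin : Real.sin (Real.pi + u / 2) = -Real.sin (u / 2) := by
        rw [add_comm, Real.sin_add_pi]
      rw [hsin] at hJ
      have habs : -Real.sin (u / 2) ≤ |Real.sin (u / 2)| := neg_le_abs _
      have h := lt_of_le_of_lt (hJ.trans habs) hs
      have h' : Real.pi + u / 2 < Real.pi / 2 * η := by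
        by_contra hc
        rw [not_lt] at hc
        have := mul_le_mul_of_nonneg_left hc (le_of_lt (div_pos two_pos hπ))
        rw [show 2 / Real.pi * (Real.pi / 2 * η) = η by field_simp] at this
        linarith
      linarith
    · -- `u/2 ∈ (π/2, π)`: use the angle `π − u/2 ∈ (0, π/2)`
      right; left
      have hlt : Real.pi / 2 < u / 2 := by
        rw [abs_of_pos hpos] at hmid; exact hmid
      have h1 : 0 ≤ Real.pi - u / 2 := by linarith
      have h2 : Real.pi - u / 2 ≤ Real.pi / 2 := by linarith
      have hJ := Real.mul_le_sin h1 h2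
      rw [Real.sin_pi_sub] at hJ
      have habs : Real.sin (u / 2) ≤ |Real.sin (u / 2)| := le_abs_self _
      have h := lt_of_le_of_lt (hJ.trans habs) hs
      have h' : Real.pi - u / 2 < Real.pi / 2 * η := by
        by_contra hc
        rw [not_lt] at hc
        have := mul_le_mul_of_nonneg_left hc (le_of_lt (div_pos two_pos hπ))
        rw [show 2 / Real.pi * (Real.pi / 2 * η) = η by field_simp] at this
        linarith
      linarith

/-- **One-dimensional tube bound.** For `y ∈ (−π, π]` and `0 < η`:
`vol{x ∈ (−π,π] : |sin((x − y)/2)| < η} ≤ 4πη`. [folklore] -/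
theorem volume_cell_abs_sin_half_lt_le {y η : ℝ} (hy : y ∈ Ioc (-Real.pi) Real.pi) (hη : 0 < η) :
    volume.restrict (Ioc (-Real.pi) Real.pi) {x : ℝ | |Real.sin ((x - y) / 2)| < η} ≤
      ENNReal.ofReal (4 * Real.pi * η) := by
  have hπ := Real.pi_pos
  have hmeas : MeasurableSet {x : ℝ | |Real.sin ((x - y) / 2)| < η} :=
    measurableSet_lt ((Real.continuous_sin.measurable.comp (by fun_prop)).abs) measurable_const
  rw [Measure.restrict_apply hmeas]
  -- the covering by three windows
  have hsub : {x : ℝ | |Real.sin ((x - y) / 2)| < η} ∩ Ioc (-Real.pi) Real.pi ⊆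
      Ioo (y - Real.pi * η) (y + Real.pi * η) ∪
        (Ioc (Real.pi - Real.pi * η) Real.pi ∪ Ioo (-Real.pi) (-Real.pi + Real.pi * η)) := by
    intro x hx
    obtain ⟨hs, hx1, hx2⟩ := hx
    have hu : |x - y| < 2 * Real.pi := by
      rw [abs_lt]; constructor <;> linarith [hy.1, hy.2]
    rcases abs_sin_half_lt_windows hu hs with h | h | h
    · left
      rw [abs_lt] at h
      exact ⟨by linarith, by linarith⟩
    · right; left
      exact ⟨by linarith [hy.1], hx2⟩
    · right; right
      exact ⟨hx1, by linarith [hy.2]⟩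
  calc volume ({x : ℝ | |Real.sin ((x - y) / 2)| < η} ∩ Ioc (-Real.pi) Real.pi)
      ≤ volume (Ioo (y - Real.pi * η) (y + Real.pi * η) ∪
          (Ioc (Real.pi - Real.pi * η) Real.pi ∪ Ioo (-Real.pi) (-Real.pi + Real.pi * η))) := measure_mono hsub
    _ ≤ volume (Ioo (y - Real.pi * η) (y + Real.pi * η)) +
          (volume (Ioc (Real.pi - Real.pi * η) Real.pi) + volume (Ioo (-Real.pi) (-Real.pi + Real.pi * η))) :=
        (measure_union_le _ _).trans (add_le_add le_rfl (measure_union_le _ _))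
    _ = ENNReal.ofReal (4 * Real.pi * η) := by
        rw [Real.volume_Ioo, Real.volume_Ioc, Real.volume_Ioo,
          show y + Real.pi * η - (y - Real.pi * η) = 2 * (Real.pi * η) by ring,
          show Real.pi - (Real.pi - Real.pi * η) = Real.pi * η by ring,
          show -Real.pi + Real.pi * η - -Real.pi = Real.pi * η by ring,
          ← ENNReal.ofReal_add (by positivity) (by positivity),
          ← ENNReal.ofReal_add (by positivity) (by positivity)]
        congr 1
        ring

/-! ### The tube around the diagonal -/

/-- **Registered sub-goal `cellMeasure_tube_diag_le` (G-T6a): the tube around the diagonal is `O(η²)`.** On the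
cell `(−π,π]³` read at `p = (k₁,(k₃,k₂))`, for `0 < η` (no upper bound needed):
`μ_cell {p : sin²((k₃−k₁)/2) + sin²((k₃−k₂)/2) < η²} ≤ 32π³η²`. [folklore] -/
theorem cellMeasure_tube_diag_le :
    ∀ η : ℝ, 0 < η →
      ((volume.restrict (Set.Ioc (-Real.pi) Real.pi)).prod
          ((volume.restrict (Set.Ioc (-Real.pi) Real.pi)).prod (volume.restrict (Set.Ioc (-Real.pi) Real.pi))))
        {p : ℝ × ℝ × ℝ | Real.sin ((p.2.1 - p.1) / 2) ^ 2 + Real.sin ((p.2.1 - p.2.2) / 2) ^ 2 < η ^ 2} ≤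
      ENNReal.ofReal (32 * Real.pi ^ 3 * η ^ 2) := by
  intro η hη
  have hπ := Real.pi_pos
  set μ₁ : Measure ℝ := volume.restrict (Set.Ioc (-Real.pi) Real.pi) with hμ₁
  -- the larger, product-shaped set
  set T : Set (ℝ × ℝ × ℝ) := {p | |Real.sin ((p.2.1 - p.1) / 2)| < η ∧ |Real.sin ((p.2.1 - p.2.2) / 2)| < η}
    with hT
  have hsub : {p : ℝ × ℝ × ℝ | Real.sin ((p.2.1 - p.1) / 2) ^ 2 + Real.sin ((p.2.1 - p.2.2) / 2) ^ 2 < η ^ 2} ⊆ T := by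
    intro p hp
    simp only [mem_setOf_eq] at hp ⊢
    constructor
    · have h : Real.sin ((p.2.1 - p.1) / 2) ^ 2 < η ^ 2 := by nlinarith [sq_nonneg (Real.sin ((p.2.1 - p.2.2) / 2))]
      exact abs_lt_of_sq_lt_sq' h hη.le |>.elim (fun h1 h2 => abs_lt.2 ⟨h1, h2⟩)
    · have h : Real.sin ((p.2.1 - p.2.2) / 2) ^ 2 < η ^ 2 := by nlinarith [sq_nonneg (Real.sin ((p.2.1 - p.1) / 2))]
      exact abs_lt_of_sq_lt_sq' h hη.le |>.elim (fun h1 h2 => abs_lt.2 ⟨h1, h2⟩)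
  refine (measure_mono hsub).trans ?_
  -- measurability
  have m1 : Measurable fun p : ℝ × ℝ × ℝ => |Real.sin ((p.2.1 - p.1) / 2)| :=
    (Real.continuous_sin.measurable.comp (by fun_prop)).abs
  have m2 : Measurable fun p : ℝ × ℝ × ℝ => |Real.sin ((p.2.1 - p.2.2) / 2)| :=
    (Real.continuous_sin.measurable.comp (by fun_prop)).abs
  have hTm : MeasurableSet T := by
    rw [hT]
    exact (measurableSet_lt m1 measurable_const).inter (measurableSet_lt m2 measurable_const)
  -- first Tonelli slice: fix `k₁`
  rw [Measure.prod_apply hTm]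
  -- the slice at `k₁`
  have hslice : ∀ k₁ : ℝ, k₁ ∈ Ioc (-Real.pi) Real.pi →
      (μ₁.prod μ₁) (Prod.mk k₁ ⁻¹' T) ≤ ENNReal.ofReal (4 * Real.pi * η) * ENNReal.ofReal (4 * Real.pi * η) := by
    intro k₁ hk₁
    have hpre : Prod.mk k₁ ⁻¹' T =
        {q : ℝ × ℝ | |Real.sin ((q.1 - k₁) / 2)| < η ∧ |Real.sin ((q.1 - q.2) / 2)| < η} := by
      ext q; simp [hT]
    have n1 : Measurable fun q : ℝ × ℝ => |Real.sin ((q.1 - k₁) / 2)| :=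
      (Real.continuous_sin.measurable.comp (by fun_prop)).abs
    have n2 : Measurable fun q : ℝ × ℝ => |Real.sin ((q.1 - q.2) / 2)| :=
      (Real.continuous_sin.measurable.comp (by fun_prop)).abs
    have hQm : MeasurableSet {q : ℝ × ℝ | |Real.sin ((q.1 - k₁) / 2)| < η ∧ |Real.sin ((q.1 - q.2) / 2)| < η} :=
      (measurableSet_lt n1 measurable_const).inter (measurableSet_lt n2 measurable_const)
    rw [hpre, Measure.prod_apply hQm]
    -- second slice: fix `k₃`; the `k₂`-section is a 1-D tube (or empty)
    have hsec : ∀ k₃ : ℝ, k₃ ∈ Ioc (-Real.pi) Real.pi →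
        μ₁ (Prod.mk k₃ ⁻¹' {q : ℝ × ℝ | |Real.sin ((q.1 - k₁) / 2)| < η ∧ |Real.sin ((q.1 - q.2) / 2)| < η}) ≤
          {k₃ : ℝ | |Real.sin ((k₃ - k₁) / 2)| < η}.indicator (fun _ => ENNReal.ofReal (4 * Real.pi * η)) k₃ := by
      intro k₃ hk₃
      by_cases h3 : |Real.sin ((k₃ - k₁) / 2)| < η
      · rw [indicator_of_mem (show k₃ ∈ {k₃ : ℝ | |Real.sin ((k₃ - k₁) / 2)| < η} from h3)]
        have hpre2 : Prod.mk k₃ ⁻¹' {q : ℝ × ℝ | |Real.sin ((q.1 - k₁) / 2)| < η ∧ |Real.sin ((q.1 - q.2) / 2)| < η} ⊆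
            {x : ℝ | |Real.sin ((x - k₃) / 2)| < η} := by
          intro x hx
          simp only [mem_preimage, mem_setOf_eq] at hx ⊢
          rw [show (x - k₃) / 2 = -((k₃ - x) / 2) by ring, Real.sin_neg, abs_neg]
          exact hx.2
        exact (measure_mono hpre2).trans (volume_cell_abs_sin_half_lt_le hk₃ hη)
      · rw [indicator_of_notMem (show k₃ ∉ {k₃ : ℝ | |Real.sin ((k₃ - k₁) / 2)| < η} from h3)]
        have hpre2 : Prod.mk k₃ ⁻¹' {q : ℝ × ℝ | |Real.sin ((q.1 - k₁) / 2)| < η ∧ |Real.sin ((q.1 - q.2) / 2)| < η} = ∅ := by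
          ext x
          simp only [mem_preimage, mem_setOf_eq, mem_empty_iff_false, iff_false, not_and]
          intro h; exact absurd h h3
        rw [hpre2, measure_empty]
    have hm3 : MeasurableSet {k₃ : ℝ | |Real.sin ((k₃ - k₁) / 2)| < η} :=
      measurableSet_lt ((Real.continuous_sin.measurable.comp (by fun_prop)).abs) measurable_const
    calc ∫⁻ k₃, μ₁ (Prod.mk k₃ ⁻¹' {q : ℝ × ℝ | |Real.sin ((q.1 - k₁) / 2)| < η ∧ |Real.sin ((q.1 - q.2) / 2)| < η}) ∂μ₁
        ≤ ∫⁻ k₃, {k₃ : ℝ | |Real.sin ((k₃ - k₁) / 2)| < η}.indicator (fun _ => ENNReal.ofReal (4 * Real.pi * η)) k₃ ∂μ₁ := by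
          rw [hμ₁]
          exact setLIntegral_mono' measurableSet_Ioc fun k₃ hk₃ => hsec k₃ hk₃
      _ = ENNReal.ofReal (4 * Real.pi * η) * μ₁ {k₃ : ℝ | |Real.sin ((k₃ - k₁) / 2)| < η} :=
          lintegral_indicator_const hm3 _
      _ ≤ ENNReal.ofReal (4 * Real.pi * η) * ENNReal.ofReal (4 * Real.pi * η) := by
          gcongr
          exact volume_cell_abs_sin_half_lt_le hk₁ hη
  -- integrate the slice bound over `k₁ ∈ (−π, π]`
  calc ∫⁻ k₁, (μ₁.prod μ₁) (Prod.mk k₁ ⁻¹' T) ∂μ₁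
      ≤ ∫⁻ k₁, ENNReal.ofReal (4 * Real.pi * η) * ENNReal.ofReal (4 * Real.pi * η) ∂μ₁ := by
        rw [hμ₁]
        exact setLIntegral_mono' measurableSet_Ioc fun k₁ hk₁ => hslice k₁ hk₁
    _ = ENNReal.ofReal (4 * Real.pi * η) * ENNReal.ofReal (4 * Real.pi * η) * μ₁ univ := lintegral_const _
    _ = ENNReal.ofReal (32 * Real.pi ^ 3 * η ^ 2) := by
        rw [hμ₁, Measure.restrict_apply_univ, Real.volume_Ioc, show Real.pi - -Real.pi = 2 * Real.pi by ring,
          ← ENNReal.ofReal_mul (by positivity), ← ENNReal.ofReal_mul (by positivity)]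
        congr 1
        ring

end Summit.AtomisticToContinuum.FouriersLaw.Theorems.DrudeDissolution.KineticPolymerGasOnTheTimeAxis

end
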